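import Summits.MatrixMultiplication.MatrixMultiplication.Theorems.SaturationLadderCuspDial
import Summits.MatrixMultiplication.MatrixMultiplication.Theorems.FarEdgeDescentTowerLimit
import HarnessLib

/-!
# Route `SaturationLadder` on Strassen's spectrum, IX: the HEIGHT CEILING of a thin clause

decomp-mm lens 1 «grading / quantitative ladder», gen 46, kernel K46-H (chain file 9, companion of files 7/8
`SaturationLadderCuspModulus` / `SaturationLadderCuspDial`).  Def-free, sorry-free support beneath the deciding crux
`SubexpSaturation` (stmt-MatrixMultiplication-25909) of `route-MatrixMultiplication-SaturationLadder`; cut of record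
UNCHANGED.  Notation as in files 7/8: universal spectral point `φ`, `θ = specMMPoint K φ`, darkness `d = θ₀+θ₁+θ₂−2`,
height `θ₁`, depth `ε₂ = 1−θ₂`, log-aspect `u = log(θ₁/ε₂)`; the thin clause of length `R` at `t` reads, on the
spectrum, as the ROOF `t·θ₁ ≤ (1−θ₀) + R·ε₂` (file 2's dictionary); the crux is the family `R = exp(c/(1−t))`, `c > 0`.

Files 7/8 graded the crux in MODULUS currency (`d·u ≤ κθ₁` on the cusp `ε₂ ≤ θ₁^{1+δ}`, proved for `δ ≥ 1/θ` from route
`FarEdgeDescent`'s `RateBeyond θ`).  This file converts that grade back into CLAUSE currency — the currency of the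
crux itself — WITHOUT the high-point law, by an elementary profile of a would-be violator:
* §1 pointwise: `roof_of_shallow` (`θ₁ ≤ Rε₂ ⟹ roof`), `roof_of_pointLaw` (`d·u ≤ κθ₁`, `κ ≤ (1−t)u ⟹ roof`),
  `violator_pointwise` (a violator of the clause `(t, e^{c/(1−t)})` is off the face, DEEP `e^{c/(1−t)}ε₂ < θ₁`, has
  log-aspect `u > c/(1−t)` and darkness ratio `d/θ₁ > 1−t`), and ★ `roofClauses_of_modulus_exact`: the modulus law of
  rate `κ` yields the clauses `(t, e^{κ/(1−t)})` at the EXACT rate `κ` for all `t` near `1` (file 3 only gave `c > κ`).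
* §2 ★★ `violator_profile` / `roof_above_heightCeiling`: under the cusp law of exponent `δ₀` (every `κ > 0`), every
  violator of the clause `(t, e^{c/(1−t)})`, `t ≥ t₁(c)`, has HEIGHT `θ₁ < exp(−c/(δ₀(1−t))) = R^{−1/δ₀}` — the
  length-`R` clause is OWED ONLY BELOW HEIGHT `R^{−1/δ₀}`; ★★ `heightCeiling_of_rateBeyond`: `RateBeyond θ ⟹` ceiling
  `R^{−θ}` — the height-ceiling exponent of the thin clauses IS the far-edge rate exponent (cross-lens coupling);
  instances `heightCeiling_record` (`θ = 13/29`, route `FarEdgeDescent` kernel XXX-C4) and `heightCeiling_towerLimit`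
  (every `θ` below the tower's limiting order `0.4486…`).
* §3 `violator_window`: under the modulus law of rate `c'` a violator's log-aspect lies in the WINDOW
  `c/(1−t) < u < c'/(1−t)`; over `ℂ` this holds for every `c' > c₂ = (5 log(5/4)+3 log 2)/3` (`violator_window_classCeiling`).

Nothing here proves `ω = 2` or an open item; no definitions (gate rule D-0009).  [cite: Strassen1988, Thm. 3.8]
[cite: LottiRomani1983, Prop. 4.1] [cite: CoppersmithWinograd1990, §8] [cite: Pan1984, Thm. 17.1]
[cite: AlmanLi2026, Proposition 4.2]
-/

set_option linter.dupNamespace false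

noncomputable section

namespace Summit.MatrixMultiplication.MatrixMultiplication.Theorems.SaturationLadderHeightCeiling

open Literature.Computability.AlgebraicComplexity
open Summit.MatrixMultiplication.MatrixMultiplication.Theses.SaturationLadder
open Summit.MatrixMultiplication.MatrixMultiplication.Theorems.SaturationLadderCornerModulus
open Summit.MatrixMultiplication.MatrixMultiplication.Theorems.SaturationLadderCuspModulus
open Summit.MatrixMultiplication.MatrixMultiplication.Theorems.FarEdgeDescentTowerLimit
  (rateBeyond_towerLimit rateBeyond_of_le_thirteen_twentyNinths)

variable {K : Type} [Field K]

/-! ## §1 Pointwise roof lemmas; the clause at the EXACT rate of a modulus law -/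

/-- **Shallow points obey every roof**: `θ₁ ≤ R·(1−θ₂)` and `t ≤ 1` give `t·θ₁ ≤ θ₁ ≤ (1−θ₀) + R·(1−θ₂)`.
[folklore] [cite: AlmanLi2026, Proposition 4.2] -/
theorem roof_of_shallow {F : SpectralMap K} (hF : IsUniversalSpectralPoint K F) {t R : ℝ} (ht : t ≤ 1)
    (hsh : specMMPoint K F 1 ≤ R * (1 - specMMPoint K F 2)) :
    t * specMMPoint K F 1 ≤ (1 - specMMPoint K F 0) + R * (1 - specMMPoint K F 2) := by
  have h0 := (AlmanLi2026.prop42_mem_Icc hF 0).2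
  have h1 := (AlmanLi2026.prop42_mem_Icc hF 1).1
  nlinarith

/-- **Point law ⟹ roof**: if `d·u ≤ κ·θ₁` with `u > 0`, `κ ≤ (1−t)·u` and `R ≥ 1`, then `d ≤ (1−t)θ₁`, i.e.
`t·θ₁ ≤ (1−θ₀) + (1−θ₂) ≤ (1−θ₀) + R·(1−θ₂)`. [folklore] [cite: AlmanLi2026, Proposition 4.2] -/
theorem roof_of_pointLaw {F : SpectralMap K} (hF : IsUniversalSpectralPoint K F) {t R κ : ℝ} (hR : 1 ≤ R)
    (hu0 : 0 < Real.log (specMMPoint K F 1 / (1 - specMMPoint K F 2)))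
    (hlaw : (specMMPoint K F 0 + specMMPoint K F 1 + specMMPoint K F 2 - 2) *
        Real.log (specMMPoint K F 1 / (1 - specMMPoint K F 2)) ≤ κ * specMMPoint K F 1)
    (hκ : κ ≤ (1 - t) * Real.log (specMMPoint K F 1 / (1 - specMMPoint K F 2))) :
    t * specMMPoint K F 1 ≤ (1 - specMMPoint K F 0) + R * (1 - specMMPoint K F 2) := by
  have h1 := (AlmanLi2026.prop42_mem_Icc hF 1).1
  have h2 := (AlmanLi2026.prop42_mem_Icc hF 2).2
  have hd : (specMMPoint K F 0 + specMMPoint K F 1 + specMMPoint K F 2 - 2) *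
      Real.log (specMMPoint K F 1 / (1 - specMMPoint K F 2)) ≤
        ((1 - t) * specMMPoint K F 1) * Real.log (specMMPoint K F 1 / (1 - specMMPoint K F 2)) :=
    calc _ ≤ κ * specMMPoint K F 1 := hlaw
      _ ≤ ((1 - t) * Real.log (specMMPoint K F 1 / (1 - specMMPoint K F 2))) * specMMPoint K F 1 :=
          mul_le_mul_of_nonneg_right hκ h1
      _ = ((1 - t) * specMMPoint K F 1) * Real.log (specMMPoint K F 1 / (1 - specMMPoint K F 2)) := by ring
  have hd' := le_of_mul_le_mul_right hd hu0
  have hε : 0 ≤ (R - 1) * (1 - specMMPoint K F 2) := mul_nonneg (by linarith) (by linarith)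
  have e : R * (1 - specMMPoint K F 2) = (1 - specMMPoint K F 2) + (R - 1) * (1 - specMMPoint K F 2) := by ring
  linarith

/-- **Deep below an exponential**: `exp L · b < a` with `b > 0` gives `a > 0` and `L < log(a/b)`. [folklore] -/
theorem lt_log_div_of_exp_mul_lt {a b L : ℝ} (hb : 0 < b) (h : Real.exp L * b < a) :
    0 < a ∧ L < Real.log (a / b) := by
  have hRpos := Real.exp_pos L
  have ha : 0 < a := lt_of_le_of_lt (mul_nonneg hRpos.le hb.le) h
  have hq : Real.exp L < a / b := (lt_div_iff₀ hb).2 h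
  have := Real.log_lt_log hRpos hq
  rw [Real.log_exp] at this
  exact ⟨ha, this⟩

/-- **A violator, pointwise**: if `φ` violates the roof of the clause `(t, exp(c/(1−t)))` (`c > 0`, `t < 1`), then
`θ₂ < 1` (the face `θ₂ = 1` is light, file 3), it is DEEP `exp(c/(1−t))·(1−θ₂) < θ₁` (so `θ₁ > 0`), its log-aspect
exceeds `c/(1−t)`, and its darkness ratio exceeds `1−t`: `(1−t)θ₁ < θ₀+θ₁+θ₂−2`.  No thresholds involved.
[cite: AlmanLi2026, Proposition 4.2] [cite: Strassen1988, Thm. 3.8] -/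
theorem violator_pointwise {F : SpectralMap K} (hF : IsUniversalSpectralPoint K F) {c t : ℝ} (hc : 0 < c)
    (ht1 : t < 1)
    (hnot : ¬ (t * specMMPoint K F 1 ≤
      (1 - specMMPoint K F 0) + Real.exp (c / (1 - t)) * (1 - specMMPoint K F 2))) :
    specMMPoint K F 2 < 1 ∧ 0 < specMMPoint K F 1 ∧
      Real.exp (c / (1 - t)) * (1 - specMMPoint K F 2) < specMMPoint K F 1 ∧
      c / (1 - t) < Real.log (specMMPoint K F 1 / (1 - specMMPoint K F 2)) ∧
      (1 - t) * specMMPoint K F 1 < specMMPoint K F 0 + specMMPoint K F 1 + specMMPoint K F 2 - 2 := by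
  have h2 := (AlmanLi2026.prop42_mem_Icc hF 2).2
  have hlt2 : specMMPoint K F 2 < 1 := by
    by_contra hge
    exact hnot (roof_of_face hF (le_antisymm h2 (not_lt.1 hge)) (Real.exp (c / (1 - t))) ht1.le)
  have hε : 0 < 1 - specMMPoint K F 2 := by linarith
  have hdeep : Real.exp (c / (1 - t)) * (1 - specMMPoint K F 2) < specMMPoint K F 1 := by
    by_contra hge
    exact hnot (roof_of_shallow hF ht1.le (not_lt.1 hge))
  obtain ⟨hθ1, hu⟩ := lt_log_div_of_exp_mul_lt hε hdeep
  refine ⟨hlt2, hθ1, hdeep, hu, ?_⟩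
  have hn := not_le.1 hnot
  have hR1 : 1 ≤ Real.exp (c / (1 - t)) := Real.one_le_exp (div_nonneg hc.le (by linarith))
  have hx : 0 ≤ (Real.exp (c / (1 - t)) - 1) * (1 - specMMPoint K F 2) := mul_nonneg (by linarith) hε.le
  have e : Real.exp (c / (1 - t)) * (1 - specMMPoint K F 2) =
      (1 - specMMPoint K F 2) + (Real.exp (c / (1 - t)) - 1) * (1 - specMMPoint K F 2) := by ring
  linarith

/-- ★ **CLAUSES AT THE EXACT RATE OF A MODULUS LAW** (every field): if `d·u ≤ κ·θ₁` for all universal `φ` off the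
face with `u ≥ u₀` (`κ > 0`), then the clause `(t, exp(κ/(1−t)))` holds for every `t ∈ [1 − κ/(2·max(u₀,1)), 1)`:
a violator would be deep, hence have `u > κ/(1−t) ≥ u₀`, and then the law with `κ ≤ (1−t)u` restores the roof.
(File 3's `roofClauses_of_modulus` reached only the rates `c > κ`.) [cite: Strassen1988, Thm. 3.8]
[cite: CoppersmithWinograd1990, §8] -/
theorem roofClauses_of_modulus_exact {κ : ℝ} (hκ : 0 < κ)
    (h : ∃ u₀ : ℝ, ∀ F : SpectralMap K, IsUniversalSpectralPoint K F → specMMPoint K F 2 < 1 →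
      u₀ ≤ Real.log (specMMPoint K F 1 / (1 - specMMPoint K F 2)) →
        (specMMPoint K F 0 + specMMPoint K F 1 + specMMPoint K F 2 - 2) *
            Real.log (specMMPoint K F 1 / (1 - specMMPoint K F 2)) ≤ κ * specMMPoint K F 1) :
    ∃ t₀ : ℝ, t₀ < 1 ∧ ∀ t : ℝ, t₀ ≤ t → t < 1 →
      ∀ F : SpectralMap K, IsUniversalSpectralPoint K F →
        t * specMMPoint K F 1 ≤
          (1 - specMMPoint K F 0) + Real.exp (κ / (1 - t)) * (1 - specMMPoint K F 2) := by
  obtain ⟨u₀, hu₀⟩ := h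
  have hU : 0 < max u₀ 1 := lt_of_lt_of_le one_pos (le_max_right _ _)
  have hU₀ : u₀ ≤ max u₀ 1 := le_max_left _ _
  have hκU : 0 < κ / (2 * max u₀ 1) := div_pos hκ (by positivity)
  refine ⟨1 - κ / (2 * max u₀ 1), by linarith, fun t ht ht1 F hF => ?_⟩
  by_contra hnot
  obtain ⟨hlt2, hθ1, hdeep, hu, hdark⟩ := violator_pointwise hF hκ ht1 hnot
  have hs : 0 < 1 - t := by linarith
  have hsU : max u₀ 1 ≤ κ / (1 - t) := by
    rw [le_div_iff₀ hs]
    have h' : 1 - t ≤ κ / (2 * max u₀ 1) := by linarith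
    have h'' := (le_div_iff₀ (by positivity : (0 : ℝ) < 2 * max u₀ 1)).1 h'
    nlinarith
  have hu0 : 0 < Real.log (specMMPoint K F 1 / (1 - specMMPoint K F 2)) := lt_trans (div_pos hκ hs) hu
  have hlaw := hu₀ F hF hlt2 (by linarith)
  have hk : κ ≤ (1 - t) * Real.log (specMMPoint K F 1 / (1 - specMMPoint K F 2)) := by
    have := (div_lt_iff₀ hs).1 hu
    linarith
  have hR1 : 1 ≤ Real.exp (κ / (1 - t)) := Real.one_le_exp (div_nonneg hκ.le hs.le)
  exact hnot (roof_of_pointLaw hF hR1 hu0 hlaw hk)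

/-! ## §2 The height ceiling of a thin clause -/

/-- ★★ **VIOLATOR PROFILE under the cusp law**: suppose the corner modulus law holds on the cusp of exponent `δ₀ > 0`
for EVERY rate `κ > 0` (`θ₂ < 1`, `u ≥ u₀(κ)`, `1−θ₂ ≤ θ₁^{1+δ₀} ⟹ d·u ≤ κθ₁`; a theorem for `δ₀ ≥ 1/θ` under
`RateBeyond θ`, file 7).  Then for every `c > 0` there is `t₁ < 1` such that every violator of the clause
`(t, exp(c/(1−t)))`, `t ∈ [t₁,1)`, satisfies: `θ₂ < 1`, `θ₁ > 0`, DEEP `exp(c/(1−t))(1−θ₂) < θ₁`, OUTSIDE THE CUSP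
`θ₁^{1+δ₀} < 1−θ₂`, BELOW THE HEIGHT CEILING `θ₁ < exp(−c/(δ₀(1−t)))`, log-aspect `> c/(1−t)`, darkness ratio `> 1−t`.
(Outside the cusp: else the cusp law at rate `κ = c` and `u > c/(1−t)` give the roof.  Ceiling: `θ₁^{1+δ₀} < ε₂ <
θ₁·exp(−c/(1−t))`.) [cite: Strassen1988, Thm. 3.8] [cite: LottiRomani1983, Prop. 4.1] [cite: AlmanLi2026, Proposition 4.2] -/
theorem violator_profile {δ₀ : ℝ} (hδ₀ : 0 < δ₀)
    (hcusp : ∀ κ : ℝ, 0 < κ → ∃ u₀ : ℝ, ∀ F : SpectralMap K, IsUniversalSpectralPoint K F →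
      specMMPoint K F 2 < 1 → u₀ ≤ Real.log (specMMPoint K F 1 / (1 - specMMPoint K F 2)) →
        1 - specMMPoint K F 2 ≤ specMMPoint K F 1 ^ (1 + δ₀) →
          (specMMPoint K F 0 + specMMPoint K F 1 + specMMPoint K F 2 - 2) *
              Real.log (specMMPoint K F 1 / (1 - specMMPoint K F 2)) ≤ κ * specMMPoint K F 1)
    {c : ℝ} (hc : 0 < c) :
    ∃ t₁ : ℝ, t₁ < 1 ∧ ∀ t : ℝ, t₁ ≤ t → t < 1 → ∀ F : SpectralMap K, IsUniversalSpectralPoint K F →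
      ¬ (t * specMMPoint K F 1 ≤
          (1 - specMMPoint K F 0) + Real.exp (c / (1 - t)) * (1 - specMMPoint K F 2)) →
        specMMPoint K F 2 < 1 ∧ 0 < specMMPoint K F 1 ∧
          Real.exp (c / (1 - t)) * (1 - specMMPoint K F 2) < specMMPoint K F 1 ∧
          specMMPoint K F 1 ^ (1 + δ₀) < 1 - specMMPoint K F 2 ∧
          specMMPoint K F 1 < Real.exp (-(c / (δ₀ * (1 - t)))) ∧
          c / (1 - t) < Real.log (specMMPoint K F 1 / (1 - specMMPoint K F 2)) ∧
          (1 - t) * specMMPoint K F 1 < specMMPoint K F 0 + specMMPoint K F 1 + specMMPoint K F 2 - 2 := by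
  obtain ⟨u₀, hu₀⟩ := hcusp c hc
  have hU : 0 < max u₀ 1 := lt_of_lt_of_le one_pos (le_max_right _ _)
  have hU₀ : u₀ ≤ max u₀ 1 := le_max_left _ _
  have hcU : 0 < c / (2 * max u₀ 1) := div_pos hc (by positivity)
  refine ⟨1 - c / (2 * max u₀ 1), by linarith, fun t ht ht1 F hF hnot => ?_⟩
  obtain ⟨hlt2, hθ1, hdeep, hu, hdark⟩ := violator_pointwise hF hc ht1 hnot
  have hs : 0 < 1 - t := by linarith
  have hε : 0 < 1 - specMMPoint K F 2 := by linarith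
  have hRpos : 0 < Real.exp (c / (1 - t)) := Real.exp_pos _
  have hR1 : 1 ≤ Real.exp (c / (1 - t)) := Real.one_le_exp (div_nonneg hc.le hs.le)
  have hsU : max u₀ 1 ≤ c / (1 - t) := by
    rw [le_div_iff₀ hs]
    have h' : 1 - t ≤ c / (2 * max u₀ 1) := by linarith
    have h'' := (le_div_iff₀ (by positivity : (0 : ℝ) < 2 * max u₀ 1)).1 h'
    nlinarith
  have hu0 : 0 < Real.log (specMMPoint K F 1 / (1 - specMMPoint K F 2)) := lt_trans (div_pos hc hs) hu
  have huU : u₀ ≤ Real.log (specMMPoint K F 1 / (1 - specMMPoint K F 2)) := by linarith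
  -- outside the cusp: else the cusp law at rate `c` restores the roof
  have hshallow : specMMPoint K F 1 ^ (1 + δ₀) < 1 - specMMPoint K F 2 := by
    by_contra hge
    have hlaw := hu₀ F hF hlt2 huU (not_lt.1 hge)
    have hk : c ≤ (1 - t) * Real.log (specMMPoint K F 1 / (1 - specMMPoint K F 2)) := by
      have := (div_lt_iff₀ hs).1 hu
      linarith
    exact hnot (roof_of_pointLaw hF hR1 hu0 hlaw hk)
  -- below the ceiling: `θ₁^{δ₀} < exp(−c/(1−t))`
  have hpow : specMMPoint K F 1 ^ δ₀ < Real.exp (-(c / (1 - t))) := by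
    have e1 : specMMPoint K F 1 ^ (1 + δ₀) = specMMPoint K F 1 * specMMPoint K F 1 ^ δ₀ := by
      rw [Real.rpow_add hθ1, Real.rpow_one]
    have h3 : specMMPoint K F 1 ^ (1 + δ₀) < specMMPoint K F 1 / Real.exp (c / (1 - t)) :=
      lt_trans hshallow ((lt_div_iff₀ hRpos).2 (by linarith))
    rw [e1, div_eq_mul_inv, ← Real.exp_neg] at h3
    exact lt_of_mul_lt_mul_left h3 hθ1.le
  have hheight : specMMPoint K F 1 < Real.exp (-(c / (δ₀ * (1 - t)))) := by
    by_contra hge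
    have hge' := not_lt.1 hge
    have h4 := Real.rpow_le_rpow (Real.exp_pos _).le hge' hδ₀.le
    rw [← Real.exp_mul] at h4
    have e : -(c / (δ₀ * (1 - t))) * δ₀ = -(c / (1 - t)) := by
      field_simp
    rw [e] at h4
    linarith
  exact ⟨hlt2, hθ1, hdeep, hshallow, hheight, hu, hdark⟩

/-- ★★ **THE CLAUSE IS OWED ONLY BELOW THE CEILING**: under the cusp law of exponent `δ₀ > 0` (every `κ > 0`), for
every `c > 0` and `t ∈ [t₁(c), 1)`, every universal `φ` of height `θ₁ ≥ exp(−c/(δ₀(1−t))) = R^{−1/δ₀}`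
(`R = exp(c/(1−t))`) obeys the roof of the clause `(t, R)`. [cite: Strassen1988, Thm. 3.8] [cite: LottiRomani1983, Prop. 4.1] -/
theorem roof_above_heightCeiling {δ₀ : ℝ} (hδ₀ : 0 < δ₀)
    (hcusp : ∀ κ : ℝ, 0 < κ → ∃ u₀ : ℝ, ∀ F : SpectralMap K, IsUniversalSpectralPoint K F →
      specMMPoint K F 2 < 1 → u₀ ≤ Real.log (specMMPoint K F 1 / (1 - specMMPoint K F 2)) →
        1 - specMMPoint K F 2 ≤ specMMPoint K F 1 ^ (1 + δ₀) →
          (specMMPoint K F 0 + specMMPoint K F 1 + specMMPoint K F 2 - 2) *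
              Real.log (specMMPoint K F 1 / (1 - specMMPoint K F 2)) ≤ κ * specMMPoint K F 1)
    {c : ℝ} (hc : 0 < c) :
    ∃ t₁ : ℝ, t₁ < 1 ∧ ∀ t : ℝ, t₁ ≤ t → t < 1 → ∀ F : SpectralMap K, IsUniversalSpectralPoint K F →
      Real.exp (-(c / (δ₀ * (1 - t)))) ≤ specMMPoint K F 1 →
        t * specMMPoint K F 1 ≤
          (1 - specMMPoint K F 0) + Real.exp (c / (1 - t)) * (1 - specMMPoint K F 2) := by
  obtain ⟨t₁, ht₁, h⟩ := violator_profile hδ₀ hcusp hc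
  refine ⟨t₁, ht₁, fun t ht ht1 F hF hh => ?_⟩
  by_contra hnot
  have := (h t ht ht1 F hF hnot).2.2.2.2.1
  linarith

/-- ★★ **VIOLATOR PROFILE UNDER THE RATE DIAL** (every field): `RateBeyond θ` (`θ > 0`:
`∃ ρ > θ ∃ C ∀ k ≥ 1, ω(1,k,1) − (k+1) ≤ C·k^{−ρ}`) ⟹ for every `c > 0` there is `t₁ < 1` such that every
violator of the clause `(t, exp(c/(1−t)))`, `t ∈ [t₁,1)`, is off the face, deep, outside the cusp of exponent `1/θ`,
of HEIGHT `θ₁ < exp(−θc/(1−t)) = R^{−θ}`, with log-aspect `> c/(1−t)` and darkness ratio `> 1−t`.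
(File 7's `cuspModulus_of_rateBeyond` + `violator_profile`.) [cite: LottiRomani1983, Prop. 4.1] [cite: Pan1984, Thm. 17.1] -/
theorem violator_profile_of_rateBeyond {θ : ℝ} (hθ : 0 < θ)
    (hR : ∃ ρ C : ℝ, θ < ρ ∧ ∀ k : ℕ, 1 ≤ k → omegaRect K 1 k 1 - (k + 1) ≤ C * (k : ℝ) ^ (-ρ))
    {c : ℝ} (hc : 0 < c) :
    ∃ t₁ : ℝ, t₁ < 1 ∧ ∀ t : ℝ, t₁ ≤ t → t < 1 → ∀ F : SpectralMap K, IsUniversalSpectralPoint K F →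
      ¬ (t * specMMPoint K F 1 ≤
          (1 - specMMPoint K F 0) + Real.exp (c / (1 - t)) * (1 - specMMPoint K F 2)) →
        specMMPoint K F 2 < 1 ∧ 0 < specMMPoint K F 1 ∧
          Real.exp (c / (1 - t)) * (1 - specMMPoint K F 2) < specMMPoint K F 1 ∧
          specMMPoint K F 1 ^ (1 + 1 / θ) < 1 - specMMPoint K F 2 ∧
          specMMPoint K F 1 < Real.exp (-(θ * c / (1 - t))) ∧
          c / (1 - t) < Real.log (specMMPoint K F 1 / (1 - specMMPoint K F 2)) ∧
          (1 - t) * specMMPoint K F 1 < specMMPoint K F 0 + specMMPoint K F 1 + specMMPoint K F 2 - 2 := by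
  obtain ⟨t₁, ht₁, h⟩ := violator_profile (K := K) (one_div_pos.2 hθ)
    (fun κ hκ => cuspModulus_of_rateBeyond hθ hR le_rfl hκ) hc
  refine ⟨t₁, ht₁, fun t ht ht1 F hF hnot => ?_⟩
  obtain ⟨h2, hθ1, hdeep, hsh, hh, hu, hd⟩ := h t ht ht1 F hF hnot
  have hs : (1 - t) ≠ 0 := ne_of_gt (by linarith)
  refine ⟨h2, hθ1, hdeep, hsh, ?_, hu, hd⟩
  have e : c / (1 / θ * (1 - t)) = θ * c / (1 - t) := by
    field_simp
  rwa [e] at hh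

/-- ★★ **HEIGHT CEILING = RATE EXPONENT** (every field): `RateBeyond θ` (`θ > 0`) ⟹ for every `c > 0` and
`t ∈ [t₁(c),1)`, the roof of the clause `(t, R)`, `R = exp(c/(1−t))`, holds at every universal `φ` of height
`θ₁ ≥ R^{−θ} = exp(−θc/(1−t))`.  Every improvement of route `FarEdgeDescent`'s rate exponent `θ` raises the power of
`1/R` below which alone the clause can still fail — with no new argument on this route.
[cite: LottiRomani1983, Prop. 4.1] [cite: Pan1984, Thm. 17.1] [cite: Strassen1988, Thm. 3.8] -/
theorem heightCeiling_of_rateBeyond {θ : ℝ} (hθ : 0 < θ)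
    (hR : ∃ ρ C : ℝ, θ < ρ ∧ ∀ k : ℕ, 1 ≤ k → omegaRect K 1 k 1 - (k + 1) ≤ C * (k : ℝ) ^ (-ρ))
    {c : ℝ} (hc : 0 < c) :
    ∃ t₁ : ℝ, t₁ < 1 ∧ ∀ t : ℝ, t₁ ≤ t → t < 1 → ∀ F : SpectralMap K, IsUniversalSpectralPoint K F →
      Real.exp (-(θ * c / (1 - t))) ≤ specMMPoint K F 1 →
        t * specMMPoint K F 1 ≤
          (1 - specMMPoint K F 0) + Real.exp (c / (1 - t)) * (1 - specMMPoint K F 2) := by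
  obtain ⟨t₁, ht₁, h⟩ := violator_profile_of_rateBeyond hθ hR hc
  refine ⟨t₁, ht₁, fun t ht ht1 F hF hh => ?_⟩
  by_contra hnot
  have := (h t ht ht1 F hF hnot).2.2.2.2.1
  linarith

/-- ★ **Instance at the rate of record** (route `FarEdgeDescent`, kernel XXX-C4 `FarEdgeDescentTowerLimit`:
`RateBeyond (13/29)` over every field): the clause `(t, R)` is owed only below height `R^{−13/29}`.
[cite: Pan1984, Thm. 17.1] [cite: LottiRomani1983, Thm. 3.1, Prop. 4.1] -/
theorem heightCeiling_record {c : ℝ} (hc : 0 < c) :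
    ∃ t₁ : ℝ, t₁ < 1 ∧ ∀ t : ℝ, t₁ ≤ t → t < 1 → ∀ F : SpectralMap K, IsUniversalSpectralPoint K F →
      Real.exp (-(13 / 29 * c / (1 - t))) ≤ specMMPoint K F 1 →
        t * specMMPoint K F 1 ≤
          (1 - specMMPoint K F 0) + Real.exp (c / (1 - t)) * (1 - specMMPoint K F 2) :=
  heightCeiling_of_rateBeyond (by norm_num) (rateBeyond_of_le_thirteen_twentyNinths K le_rfl) hc

/-- ★ **Instance at the tower's limiting order** (kernel XXX-C4, `rateBeyond_towerLimit`): with `m*` the fixed point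
of the box-tower map and `λ* = 7(1−m*)^6/(1+g(m*))`, the height ceiling `R^{−θ}` holds for EVERY
`0 < θ < log₇λ*/(1 − log₇λ*) = 0.4486…`. [cite: Pan1984, Thm. 17.1] [cite: LottiRomani1983, Thm. 3.1, Prop. 4.1] -/
theorem heightCeiling_towerLimit :
    ∃ mstar : ℝ, (17461 : ℝ) / 100000 ≤ mstar ∧ mstar ≤ 174611 / 1000000 ∧
      ((1 - mstar) ^ 7 - (1 - 2 * mstar) ^ 7) / (1 + ((1 - mstar) ^ 7 - (1 - 2 * mstar) ^ 7)) = mstar ∧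
      ∀ θ : ℝ, 0 < θ →
        θ < Real.logb 7 (7 * (1 - mstar) ^ 6 / (1 + ((1 - mstar) ^ 7 - (1 - 2 * mstar) ^ 7))) /
          (1 - Real.logb 7 (7 * (1 - mstar) ^ 6 / (1 + ((1 - mstar) ^ 7 - (1 - 2 * mstar) ^ 7)))) →
        ∀ c : ℝ, 0 < c →
          ∃ t₁ : ℝ, t₁ < 1 ∧ ∀ t : ℝ, t₁ ≤ t → t < 1 → ∀ F : SpectralMap K, IsUniversalSpectralPoint K F →
            Real.exp (-(θ * c / (1 - t))) ≤ specMMPoint K F 1 →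
              t * specMMPoint K F 1 ≤
                (1 - specMMPoint K F 0) + Real.exp (c / (1 - t)) * (1 - specMMPoint K F 2) := by
  obtain ⟨m, hm1, hm2, hfix, hrate⟩ := rateBeyond_towerLimit K
  exact ⟨m, hm1, hm2, hfix, fun θ hθ hθlt c hc => heightCeiling_of_rateBeyond hθ (hrate θ hθlt) hc⟩

/-! ## §3 The log-aspect window of a violator -/

/-- **VIOLATOR WINDOW** (every field): under the modulus law of rate `c'` beyond `u₀` (`θ₂ < 1`, `u ≥ u₀ ⟹
d·u ≤ c'·θ₁`), for every `c > 0` and `t ∈ [t₁(c),1)` a violator of the clause `(t, exp(c/(1−t)))` has log-aspect in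
the window `c/(1−t) < u < c'/(1−t)` (lower end: it is deep; upper end: `(1−t)θ₁ < d ≤ c'θ₁/u`).
[cite: Strassen1988, Thm. 3.8] [cite: CoppersmithWinograd1990, §8] -/
theorem violator_window {c' : ℝ}
    (hlaw : ∃ u₀ : ℝ, ∀ F : SpectralMap K, IsUniversalSpectralPoint K F → specMMPoint K F 2 < 1 →
      u₀ ≤ Real.log (specMMPoint K F 1 / (1 - specMMPoint K F 2)) →
        (specMMPoint K F 0 + specMMPoint K F 1 + specMMPoint K F 2 - 2) *
            Real.log (specMMPoint K F 1 / (1 - specMMPoint K F 2)) ≤ c' * specMMPoint K F 1)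
    {c : ℝ} (hc : 0 < c) :
    ∃ t₁ : ℝ, t₁ < 1 ∧ ∀ t : ℝ, t₁ ≤ t → t < 1 → ∀ F : SpectralMap K, IsUniversalSpectralPoint K F →
      ¬ (t * specMMPoint K F 1 ≤
          (1 - specMMPoint K F 0) + Real.exp (c / (1 - t)) * (1 - specMMPoint K F 2)) →
        c / (1 - t) < Real.log (specMMPoint K F 1 / (1 - specMMPoint K F 2)) ∧
          Real.log (specMMPoint K F 1 / (1 - specMMPoint K F 2)) < c' / (1 - t) := by
  obtain ⟨u₀, hu₀⟩ := hlaw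
  have hU : 0 < max u₀ 1 := lt_of_lt_of_le one_pos (le_max_right _ _)
  have hU₀ : u₀ ≤ max u₀ 1 := le_max_left _ _
  have hcU : 0 < c / (2 * max u₀ 1) := div_pos hc (by positivity)
  refine ⟨1 - c / (2 * max u₀ 1), by linarith, fun t ht ht1 F hF hnot => ?_⟩
  obtain ⟨hlt2, hθ1, hdeep, hu, hdark⟩ := violator_pointwise hF hc ht1 hnot
  have hs : 0 < 1 - t := by linarith
  have hsU : max u₀ 1 ≤ c / (1 - t) := by
    rw [le_div_iff₀ hs]
    have h' : 1 - t ≤ c / (2 * max u₀ 1) := by linarith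
    have h'' := (le_div_iff₀ (by positivity : (0 : ℝ) < 2 * max u₀ 1)).1 h'
    nlinarith
  have hu0 : 0 < Real.log (specMMPoint K F 1 / (1 - specMMPoint K F 2)) := lt_trans (div_pos hc hs) hu
  have hl := hu₀ F hF hlt2 (by linarith)
  refine ⟨hu, (lt_div_iff₀ hs).2 ?_⟩
  -- `(1−t)θ₁·u < d·u ≤ c'θ₁`, divide by `θ₁ > 0`
  have h5 : (1 - t) * specMMPoint K F 1 * Real.log (specMMPoint K F 1 / (1 - specMMPoint K F 2)) <
      c' * specMMPoint K F 1 := lt_of_lt_of_le (mul_lt_mul_of_pos_right hdark hu0) hl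
  have h6 : specMMPoint K F 1 * (Real.log (specMMPoint K F 1 / (1 - specMMPoint K F 2)) * (1 - t)) <
      specMMPoint K F 1 * c' := by nlinarith
  exact lt_of_mul_lt_mul_left h6 hθ1.le

/-- **The window over `ℂ` at the class ceiling**: over `ℂ` the modulus law of every rate `c' > c₂ =
(5 log(5/4) + 3 log 2)/3` is a theorem (file 3, `modulus_above_classCeiling`), so for every `c > 0`, `c' > c₂` and
`t ∈ [t₁,1)` a violator of the clause `(t, exp(c/(1−t)))` has `c/(1−t) < u < c'/(1−t)`: violators of the crux live in
log-aspect windows of relative width `c₂/c − 1` above `c/(1−t)`. [cite: CoppersmithWinograd1990, §8]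
[cite: Strassen1988, Thm. 3.8] -/
theorem violator_window_classCeiling {c c' : ℝ} (hc : 0 < c)
    (hc' : (5 * Real.log (5 / 4) + 3 * Real.log 2) / 3 < c') :
    ∃ t₁ : ℝ, t₁ < 1 ∧ ∀ t : ℝ, t₁ ≤ t → t < 1 → ∀ F : SpectralMap ℂ, IsUniversalSpectralPoint ℂ F →
      ¬ (t * specMMPoint ℂ F 1 ≤
          (1 - specMMPoint ℂ F 0) + Real.exp (c / (1 - t)) * (1 - specMMPoint ℂ F 2)) →
        c / (1 - t) < Real.log (specMMPoint ℂ F 1 / (1 - specMMPoint ℂ F 2)) ∧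
          Real.log (specMMPoint ℂ F 1 / (1 - specMMPoint ℂ F 2)) < c' / (1 - t) :=
  violator_window (modulus_above_classCeiling c' hc') hc

end Summit.MatrixMultiplication.MatrixMultiplication.Theorems.SaturationLadderHeightCeiling

end
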